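import Summits.CriticalPhenomena.PercolationContinuityZ3.Theorems.PercNearOneGluingNoHeavyLowerTailStarSetResidualBound
import Summits.CriticalPhenomena.PercolationContinuityZ3.Theorems.PercNearOneGluingNoHeavyLowerTailStarSetUnitBoundOfResidual
import HarnessLib

/-!
# `NoHeavyLowerTail` (stmt-CriticalPhenomena-4575) — the UNIT BOUND of the U1′_r charging scheme (LEAN-BLUEPRINT-U1.md §C; U1-PROOF.md §§2–9)

Support file (prover `prim-gen-swap` gen 15; `--supports stmt-CriticalPhenomena-4575`).  No definitions, no named facts, no sorries.

`StarSet.unit_bound` (the cell's `UnitBound.TARGET`, gen 13): the charged units `(S, X)` of the configuration expansion — `X ∈ Ω S`, and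
`X ≠ free S` when `y(S) = 1`, for the free rule "the Ω-chord through the port `q₀` of the leaf class if there is one, else the least
Ω-chord" — are paid by the credit configurations plus the class-word budget `Σ_T C_T`.  Proof: `unit_bound_of_residual` (early bound +
ledger, p220548) with the residual bound `residual_bound`; the free rule picks an Ω-chord, through `q₀` when possible.

* `StarSet.unit_bound`.
-/

namespace Summit.CriticalPhenomena.PercolationContinuityZ3.Theorems

open Finset
open scoped BigOperators Classical

namespace StarSet

variable {ι V : Type*} [Fintype ι] [LinearOrder ι] [Fintype V] [DecidableEq V]

/-- **The unit bound (LEAN-BLUEPRINT-U1 §C).**  (`[Inhabited ι]` only feeds the `default` branch of the free rule, never used on a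
charged unit.) -/
theorem unit_bound [Inhabited ι] (P P' : ι → V) (hPP' : ∀ X, P X ≠ P' X)
    (hinj : Function.Injective fun X => (s(P X, P' X) : Sym2 V)) (r : V) (F : Finset ι)
    (hforest : ∀ K ∈ F, ∀ I ∈ F, K < I → P' K ≠ P I ∧ P' K ≠ P' I)
    (θ : ι → ℝ) (hθ0 : ∀ X, 0 ≤ θ X) (hθ1 : ∀ X, θ X < 1)
    (O : ι → V → ℝ) (hO0 : ∀ X d, 0 ≤ O X d) (Φ : ι → ℝ)
    (hO1 : ∀ X d, (P X = d ∨ P' X = d) → θ X ≤ (1 - θ X) * O X d)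
    (hO2 : ∀ X, Φ X ^ 2 ≤ O X (P X) * O X (P' X))
    (hΦ4 : ∀ X, 4 * θ X ≤ Φ X) (hΦsq : ∀ X, θ X ≤ Φ X ^ 2)
    (dom : ι → V → ι)
    (hdom : ∀ X ∉ F, ∀ d, (P X = d ∨ P' X = d) →
      dom X d ∈ F ∧ (P (dom X d) = d ∨ P' (dom X d) = d) ∧
        (∀ u, (P (dom X d) = u ∨ P' (dom X d) = u) → (P X = u ∨ P' X = u) → u = d) ∧ θ X ≤ θ (dom X d)) :
    ∑ u ∈ (univ : Finset (Finset ι × ι)).filter (fun u => u.2 ∈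
        (if ((∀ I ∈ F, I ∉ u.1) ∨ ∃ a ∈ F, P a = r ∧ a ∈ u.1 ∧ ∀ b ∈ F, b < a → b ∉ u.1) then
          (u.1.filter (fun X => X ∈ (univ \ F).filter (fun κ => P κ ≠ r ∧ P' κ ≠ r) ∧
            ∀ Y ∈ u.1, (P Y = P X ∨ P Y = P' X ∨ P' Y = P X ∨ P' Y = P' X))).erase
            (if h : ∃ X ∈ u.1.filter (fun X => X ∈ (univ \ F).filter (fun κ => P κ ≠ r ∧ P' κ ≠ r) ∧
                ∀ Y ∈ u.1, (P Y = P X ∨ P Y = P' X ∨ P' Y = P X ∨ P' Y = P' X)),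
                ∃ I ∈ F, P' I = r ∧ (P X = P I ∨ P' X = P I) then h.choose
             else if h' : (u.1.filter (fun X => X ∈ (univ \ F).filter (fun κ => P κ ≠ r ∧ P' κ ≠ r) ∧
                ∀ Y ∈ u.1, (P Y = P X ∨ P Y = P' X ∨ P' Y = P X ∨ P' Y = P' X))).Nonempty then
               (u.1.filter (fun X => X ∈ (univ \ F).filter (fun κ => P κ ≠ r ∧ P' κ ≠ r) ∧
                 ∀ Y ∈ u.1, (P Y = P X ∨ P Y = P' X ∨ P' Y = P X ∨ P' Y = P' X))).min' h'
             else default)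
         else
          u.1.filter (fun X => X ∈ (univ \ F).filter (fun κ => P κ ≠ r ∧ P' κ ≠ r) ∧
            ∀ Y ∈ u.1, (P Y = P X ∨ P Y = P' X ∨ P' Y = P X ∨ P' Y = P' X)))),
        ((∏ k ∈ u.1, θ k) * ∏ k ∈ univ \ u.1, (1 - θ k)) ≤
      ∑ S ∈ (univ : Finset ι).powerset.filter (fun S =>
          S.filter (fun X => X ∈ (univ \ F).filter (fun κ => P κ ≠ r ∧ P' κ ≠ r) ∧
            ∀ Y ∈ S, (P Y = P X ∨ P Y = P' X ∨ P' Y = P X ∨ P' Y = P' X)) = ∅ ∧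
          ((∀ I ∈ F, I ∉ S) ∨ ∃ a ∈ F, P a = r ∧ a ∈ S ∧ ∀ b ∈ F, b < a → b ∉ S)),
        ((∏ k ∈ S, θ k) * ∏ k ∈ univ \ S, (1 - θ k)) +
      ∑ T ∈ (univ : Finset ι).powerset,
        ∑ δ ∈ (univ : Finset (ι → Bool)).filter (fun δ => (∀ X ∉ T, δ X = false) ∧
            3 ≤ (T.image fun X => if δ X then P X else P' X).card ∧ r ∉ T.image fun X => if δ X then P X else P' X),
          ∏ X ∈ T, O X (if δ X then P X else P' X) := by
  -- the free rule and its two properties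
  have hfree : ∀ S : Finset ι, (S.filter (fun X => X ∈ (univ \ F).filter (fun κ => P κ ≠ r ∧ P' κ ≠ r) ∧
      ∀ Y ∈ S, (P Y = P X ∨ P Y = P' X ∨ P' Y = P X ∨ P' Y = P' X))).Nonempty →
      (if h : ∃ X ∈ S.filter (fun X => X ∈ (univ \ F).filter (fun κ => P κ ≠ r ∧ P' κ ≠ r) ∧
          ∀ Y ∈ S, (P Y = P X ∨ P Y = P' X ∨ P' Y = P X ∨ P' Y = P' X)),
          ∃ I ∈ F, P' I = r ∧ (P X = P I ∨ P' X = P I) then h.choose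
       else if h' : (S.filter (fun X => X ∈ (univ \ F).filter (fun κ => P κ ≠ r ∧ P' κ ≠ r) ∧
          ∀ Y ∈ S, (P Y = P X ∨ P Y = P' X ∨ P' Y = P X ∨ P' Y = P' X))).Nonempty then
         (S.filter (fun X => X ∈ (univ \ F).filter (fun κ => P κ ≠ r ∧ P' κ ≠ r) ∧
           ∀ Y ∈ S, (P Y = P X ∨ P Y = P' X ∨ P' Y = P X ∨ P' Y = P' X))).min' h'
       else default) ∈ S.filter (fun X => X ∈ (univ \ F).filter (fun κ => P κ ≠ r ∧ P' κ ≠ r) ∧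
        ∀ Y ∈ S, (P Y = P X ∨ P Y = P' X ∨ P' Y = P X ∨ P' Y = P' X)) := by
    intro S hS
    split_ifs with h1
    · exact h1.choose_spec.1
    · exact min'_mem _ _
  have hfreeq : ∀ S : Finset ι, (∃ X ∈ S.filter (fun X => X ∈ (univ \ F).filter (fun κ => P κ ≠ r ∧ P' κ ≠ r) ∧
        ∀ Y ∈ S, (P Y = P X ∨ P Y = P' X ∨ P' Y = P X ∨ P' Y = P' X)), ∃ I ∈ F, P' I = r ∧ (P X = P I ∨ P' X = P I)) →
      ∃ I ∈ F, P' I = r ∧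
        (P (if h : ∃ X ∈ S.filter (fun X => X ∈ (univ \ F).filter (fun κ => P κ ≠ r ∧ P' κ ≠ r) ∧
            ∀ Y ∈ S, (P Y = P X ∨ P Y = P' X ∨ P' Y = P X ∨ P' Y = P' X)),
            ∃ I ∈ F, P' I = r ∧ (P X = P I ∨ P' X = P I) then h.choose
         else if h' : (S.filter (fun X => X ∈ (univ \ F).filter (fun κ => P κ ≠ r ∧ P' κ ≠ r) ∧
            ∀ Y ∈ S, (P Y = P X ∨ P Y = P' X ∨ P' Y = P X ∨ P' Y = P' X))).Nonempty then
           (S.filter (fun X => X ∈ (univ \ F).filter (fun κ => P κ ≠ r ∧ P' κ ≠ r) ∧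
             ∀ Y ∈ S, (P Y = P X ∨ P Y = P' X ∨ P' Y = P X ∨ P' Y = P' X))).min' h'
         else default) = P I ∨
         P' (if h : ∃ X ∈ S.filter (fun X => X ∈ (univ \ F).filter (fun κ => P κ ≠ r ∧ P' κ ≠ r) ∧
            ∀ Y ∈ S, (P Y = P X ∨ P Y = P' X ∨ P' Y = P X ∨ P' Y = P' X)),
            ∃ I ∈ F, P' I = r ∧ (P X = P I ∨ P' X = P I) then h.choose
         else if h' : (S.filter (fun X => X ∈ (univ \ F).filter (fun κ => P κ ≠ r ∧ P' κ ≠ r) ∧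
            ∀ Y ∈ S, (P Y = P X ∨ P Y = P' X ∨ P' Y = P X ∨ P' Y = P' X))).Nonempty then
           (S.filter (fun X => X ∈ (univ \ F).filter (fun κ => P κ ≠ r ∧ P' κ ≠ r) ∧
             ∀ Y ∈ S, (P Y = P X ∨ P Y = P' X ∨ P' Y = P X ∨ P' Y = P' X))).min' h'
         else default) = P I) := by
    intro S hS
    rw [dif_pos hS]
    exact hS.choose_spec.2
  exact unit_bound_of_residual P P' hPP' hinj r F hforest θ hθ0 hθ1 O hO0 Φ hO2 hΦ4 hΦsq dom hdom
    (fun S => if h : ∃ X ∈ S.filter (fun X => X ∈ (univ \ F).filter (fun κ => P κ ≠ r ∧ P' κ ≠ r) ∧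
        ∀ Y ∈ S, (P Y = P X ∨ P Y = P' X ∨ P' Y = P X ∨ P' Y = P' X)),
        ∃ I ∈ F, P' I = r ∧ (P X = P I ∨ P' X = P I) then h.choose
      else if h' : (S.filter (fun X => X ∈ (univ \ F).filter (fun κ => P κ ≠ r ∧ P' κ ≠ r) ∧
        ∀ Y ∈ S, (P Y = P X ∨ P Y = P' X ∨ P' Y = P X ∨ P' Y = P' X))).Nonempty then
        (S.filter (fun X => X ∈ (univ \ F).filter (fun κ => P κ ≠ r ∧ P' κ ≠ r) ∧
          ∀ Y ∈ S, (P Y = P X ∨ P Y = P' X ∨ P' Y = P X ∨ P' Y = P' X))).min' h'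
      else default)
    hfree hfreeq
    (residual_bound P P' hPP' hinj r F hforest θ hθ0 hθ1 O hO0 Φ hO1 hO2 hΦ4 hΦsq dom hdom)

end StarSet

end Summit.CriticalPhenomena.PercolationContinuityZ3.Theorems
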